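import Literature.NumberTheory.Automorphic.UnitaryThreePHTower               -- (F3c-β-ii) FILE A: `scalarCongr`, `flickerPH0`, coordinate criterion
import Literature.NumberTheory.Automorphic.UnitaryThreeBorelCosetCount        -- ★ A-p03: `exists_coe_eq_borel_of_mem_flickerPH`, `exists_mem_flickerPH_coe_eq`
import HarnessLib

/-!
# The tower for Flicker's Prop. 8 (ii), FILE B: the reduction `ρ_m : p(u,x,w) ↦ (u w⁻¹, x) mod 𝓂^m` on `P_H` — its fibres are the `N₀(ϖ^m)`-cosets (H1),
# its image is `(𝒪⧸𝓂^m)ˣ × {anti-fixed classes}` (H3)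
(Flicker, *Elementary proof of the fundamental lemma for a unitary group* (1998), Prop. 8 pp. 84–85)

Topic `NumberTheory/Automorphic`; namespace `Literature.NumberTheory.Automorphic.UnitaryGroup`.  Two small DEFINITIONS (`toQuotPow`, `flickerPHRho`) + theorems; no
instance, no notation, no named fact, no `sorry`.  Cell `pub/hodgecm-mathlib`, F0∕P3a road «N7-ns COUNT FROM FLICKER» (MAP v3, architect A-p06 (g26)), brick
**(F3c-β-ii) PROP. 8 (ii)** `[P_H : P_H ∩ H^K_m] = (q²−1)q^{4m−2}` via the TOWER `P_H ⊇ N₀(ϖ^m) ⊇ P_H ∩ H^K_m` (B-p04 (g33); plan and consumed heads (H1)–(H3) fixed by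
the LAYER C pen A-p03 (g24) 04:45:33Z ∕ tokens 04:52:13Z), over ★ FILE A `UnitaryThreePHTower` (`scalarCongr`, `flickerPH0`, `mem_flickerPH0_iff_of_coe_eq`) and ★ A-p03
`UnitaryThreeBorelCosetCount` (`P_H` in coordinates).  HC_CM is proved only modulo the printed citations until rung 0 closes; structure theory for ONE clause of
#103-ns, pays nothing by itself.

TOKENS (A-p03's pin): the ring `𝒪[K] ⧸ 𝓂[K] ^ m` (`open scoped Valued`; `𝓂[K] = IsLocalRing.maximalIdeal 𝒪[K]`), the involution on it
`Ideal.quotientMap (𝓂[K]^m) σO _` with `σO := (σ.comp 𝒪[K].subtype).codRestrict 𝒪[K] hσO`; `hd : LocalConjDatum σ ϖ`, `hc : ↑↑c = diag(1,−1,1)`, `hJ : J = Φ₃`.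
* §0 BRIDGE `mem_maximalIdeal_pow_iff_v_le (hϖ : |ϖ| = exp(−1)) : y ∈ 𝓂[K]^m ↔ |y| ≤ |ϖ^m|` (`𝓂 = (ϖ)`; no DVR instance needed).
* §1 `toQuotPow m : K → 𝒪[K] ⧸ 𝓂[K]^m` (class of an integer, `0` elsewhere), `toQuotPow_of_le`, `toQuotPow_eq_toQuotPow_iff : … ↔ |y − z| ≤ |ϖ^m|`;
  **`flickerPHRho σ m p := (toQuotPow m (p₀₀ p₁₁⁻¹), toQuotPow m (p₀₂ p₀₀⁻¹))`** = Flicker's `ρ_m`, `flickerPHRho_of_coe_eq : ρ_m (p(u,x,w)) = (u w⁻¹, x) mod 𝓂^m`;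
  `coe_inv_mul_of_coe_eq : p(u,x,w)⁻¹ p(u′,x′,w′) = p(u′∕u, x′ − x·N(u)∕N(u′), w′∕w)` (the `x`-slot is a crossed homomorphism).
* §2 **(H1) `flickerPHRho_eq_iff (hp hp′ : ∈ P_H) : ρ_m p = ρ_m p′ ↔ p⁻¹ p′ ∈ flickerPH0 σ J c (ϖ^m)`** — the fibres of `ρ_m` are the left `N₀(ϖ^m)`-cosets.
* §3 **(H3)** `comp_subtype_mem_integer` (the `hσO`), `maximalIdeal_pow_le_comap_codRestrict` (the `Ideal.quotientMap` side condition), **`isUnit_flickerPHRho_fst`**,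
  **`quotientMap_flickerPHRho_snd : σ̄ (ρ_m p)₂ = −(ρ_m p)₂`**, **`exists_mem_flickerPH_flickerPHRho_eq`** (every `(ā, b̄)` with `a ∈ 𝒪^×`, `σ̄b̄ = −b̄` is attained on `P_H`:
  `p(a, (b − σb)∕2, 1)`) — so `ρ_m(P_H) = (𝒪⧸𝓂^m)ˣ × {anti-fixed}`, of size `(q²−1)q^{2m−2}·q^m` by ★ `natCard_units_quotient_pow` ∕ ★ `natCard_antifixed_quotient_pow`
  (A-p03's currency; not restated here).
SEQUEL FILE C: (H2) `P_H ∩ H^K_m ≤ N₀(ϖ^m)` and `[N₀(ϖ^m) : P_H ∩ H^K_m] = #{anti-fixed classes mod 𝓂^m}` via the additive character `χ(p) = x∕ϖ^m + z − σz`.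

## References
* [Flicker1998UnitaryFL] Y. Z. Flicker, *Elementary proof of the fundamental lemma for a unitary group*, Canad. J. Math. 50 (1998), Prop. 8 pp. 84–85.
-/

open scoped MatrixGroups WithZero Valued
open Matrix

namespace Literature.NumberTheory.Automorphic

namespace UnitaryGroup

open Literature.NumberTheory.Automorphic.HermitianLattice (unitaryInt mem_unitaryInt_iff LocalConjDatum)

section Bridge

variable {K : Type*} [Field K] [Valued K ℤᵐ⁰] {ϖ : K}

/-- In a `ℤᵐ⁰`-valued field with `|ϖ| = exp(−1)`: `|y| < 1 → |y| ≤ |ϖ|`. [folklore] -/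
private theorem v_le_v_of_lt_one (hϖ : Valued.v ϖ = WithZero.exp (-1 : ℤ)) {y : K} (hy : Valued.v y < 1) : Valued.v y ≤ Valued.v ϖ := by
  rw [hϖ]
  rcases eq_or_ne (Valued.v y) 0 with h0 | h0
  · rw [h0]; exact zero_le
  · obtain ⟨n, hn⟩ : ∃ n : ℤ, Valued.v y = WithZero.exp n := ⟨_, (WithZero.exp_log h0).symm⟩
    rw [hn] at hy ⊢
    rw [← WithZero.exp_zero, WithZero.exp_lt_exp] at hy
    exact WithZero.exp_le_exp.2 (by omega)

/-- **The valuation ball is the ideal power**: for `y ∈ 𝒪[K]`, `y ∈ 𝓂[K]^m ↔ |y| ≤ |ϖ^m|` (`𝓂 = (ϖ)` since `|ϖ| = exp(−1)` is the largest value `< 1`).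
[cite: Flicker1998UnitaryFL, Prop. 8 p. 84] -/
theorem mem_maximalIdeal_pow_iff_v_le (hϖ : Valued.v ϖ = WithZero.exp (-1 : ℤ)) (m : ℕ) (y : 𝒪[K]) :
    y ∈ 𝓂[K] ^ m ↔ Valued.v (y : K) ≤ Valued.v (ϖ ^ m) := by
  have hϖ1 : Valued.v ϖ ≤ 1 := by rw [hϖ, ← WithZero.exp_zero]; exact WithZero.exp_le_exp.2 (by norm_num)
  have hϖ0 : ϖ ≠ 0 := fun h => by rw [h, map_zero] at hϖ; exact WithZero.zero_ne_coe hϖ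
  set ϖO : 𝒪[K] := ⟨ϖ, hϖ1⟩ with hϖO
  have hmax : 𝓂[K] = Ideal.span {ϖO} := by
    apply le_antisymm
    · intro y hy
      rw [Ideal.mem_span_singleton]
      have hy1 : Valued.v (y : K) < 1 := by
        have := (IsLocalRing.mem_maximalIdeal _).1 hy
        rw [mem_nonunits_iff, (Valuation.integer.integers (Valued.v (R := K))).isUnit_iff_valuation_eq_one] at this
        exact lt_of_le_of_ne y.2 this
      exact (Valuation.integer.integers (Valued.v (R := K))).dvd_of_le (v_le_v_of_lt_one hϖ hy1)
    · rw [Ideal.span_le, Set.singleton_subset_iff, SetLike.mem_coe, IsLocalRing.mem_maximalIdeal, mem_nonunits_iff,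
        (Valuation.integer.integers (Valued.v (R := K))).isUnit_iff_valuation_eq_one]
      change Valued.v ϖ ≠ 1
      rw [hϖ, ← WithZero.exp_zero]; exact fun h => by have := WithZero.exp_injective h; omega
  rw [hmax, Ideal.span_singleton_pow, Ideal.mem_span_singleton,
    (Valuation.integer.integers (Valued.v (R := K))).dvd_iff_le]
  rfl

end Bridge

section Rho

variable {K : Type*} [Field K] [Valued K ℤᵐ⁰] {ϖ : K} (σ : K →+* K) {J : Matrix (Fin 3) (Fin 3) K} (hJ : J = (StdForm.antidiagonal 3).over K)

/-- Reduction of an element of `K` modulo `𝓂^m` (`0` off the integers). [cite: Flicker1998UnitaryFL, Prop. 8 p. 84] -/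
noncomputable def toQuotPow (m : ℕ) (y : K) : 𝒪[K] ⧸ 𝓂[K] ^ m :=
  if h : Valued.v y ≤ 1 then Ideal.Quotient.mk (𝓂[K] ^ m) ⟨y, h⟩ else 0

omit [Valued K ℤᵐ⁰] in
/-- `toQuotPow` on an integer is its class. [cite: Flicker1998UnitaryFL, Prop. 8 p. 84] -/
theorem toQuotPow_of_le [Valued K ℤᵐ⁰] (m : ℕ) {y : K} (hy : Valued.v y ≤ 1) :
    toQuotPow m y = Ideal.Quotient.mk (𝓂[K] ^ m) ⟨y, hy⟩ := dif_pos hy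

/-- Two integers have the same reduction modulo `𝓂^m` iff `|y − z| ≤ |ϖ^m|`. [cite: Flicker1998UnitaryFL, Prop. 8 p. 84] -/
theorem toQuotPow_eq_toQuotPow_iff (hϖ : Valued.v ϖ = WithZero.exp (-1 : ℤ)) (m : ℕ) {y z : K} (hy : Valued.v y ≤ 1) (hz : Valued.v z ≤ 1) :
    toQuotPow m y = toQuotPow m z ↔ Valued.v (y - z) ≤ Valued.v (ϖ ^ m) := by
  rw [toQuotPow_of_le m hy, toQuotPow_of_le m hz, Ideal.Quotient.eq, mem_maximalIdeal_pow_iff_v_le hϖ]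
  rfl

/-- **Flicker's reduction `ρ_m : p ↦ (p₀₀ p₁₁⁻¹, p₀₂ p₀₀⁻¹) mod 𝓂^m`** — on `P_H`, `p(u,x,w) ↦ (u w⁻¹ mod 𝓂^m, x mod 𝓂^m)`. [cite: Flicker1998UnitaryFL, Prop. 8 pp. 84–85] -/
noncomputable def flickerPHRho (m : ℕ) (p : ↥(unitaryGroupOfForm σ J)) : (𝒪[K] ⧸ 𝓂[K] ^ m) × (𝒪[K] ⧸ 𝓂[K] ^ m) :=
  (toQuotPow m (((p : GL (Fin 3) K) : Matrix (Fin 3) (Fin 3) K) 0 0 * (((p : GL (Fin 3) K) : Matrix (Fin 3) (Fin 3) K) 1 1)⁻¹),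
   toQuotPow m (((p : GL (Fin 3) K) : Matrix (Fin 3) (Fin 3) K) 0 2 * (((p : GL (Fin 3) K) : Matrix (Fin 3) (Fin 3) K) 0 0)⁻¹))

/-- `ρ_m` in coordinates: `ρ_m (p(u,x,w)) = (u w⁻¹, x) mod 𝓂^m`. [cite: Flicker1998UnitaryFL, Prop. 8 pp. 84–85] -/
theorem flickerPHRho_of_coe_eq (m : ℕ) {p : ↥(unitaryGroupOfForm σ J)} {u x w : K}
    (hcoe : ((p : GL (Fin 3) K) : Matrix (Fin 3) (Fin 3) K) = !![u, 0, u * x; 0, w, 0; 0, 0, (σ u)⁻¹]) (hu0 : u ≠ 0) :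
    flickerPHRho σ m p = (toQuotPow m (u * w⁻¹), toQuotPow m x) := by
  simp only [flickerPHRho, hcoe]
  simp [mul_inv_cancel_right₀ hu0, mul_comm u x]

omit [Valued K ℤᵐ⁰] in
/-- The matrix of `p⁻¹ p′` for `p = p(u,x,w)`, `p′ = p(u′,x′,w′)` in `P_H`-coordinates: `p⁻¹p′ = p(u′∕u, x′ − x·(uσu)∕(u′σu′), w′∕w)` (the `x`-slot is a crossed
homomorphism). [cite: Flicker1998UnitaryFL, Prop. 8 p. 84] -/
theorem coe_inv_mul_of_coe_eq (hσσ : ∀ a, σ (σ a) = a) {p p' : ↥(unitaryGroupOfForm σ J)} {u x w u' x' w' : K}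
    (hcoe : ((p : GL (Fin 3) K) : Matrix (Fin 3) (Fin 3) K) = !![u, 0, u * x; 0, w, 0; 0, 0, (σ u)⁻¹])
    (hcoe' : ((p' : GL (Fin 3) K) : Matrix (Fin 3) (Fin 3) K) = !![u', 0, u' * x'; 0, w', 0; 0, 0, (σ u')⁻¹])
    (hu0 : u ≠ 0) (hw0 : w ≠ 0) (hu0' : u' ≠ 0) :
    (((p⁻¹ * p' : ↥(unitaryGroupOfForm σ J)) : GL (Fin 3) K) : Matrix (Fin 3) (Fin 3) K) =
      !![u' / u, 0, (u' / u) * (x' - x * (u * σ u) / (u' * σ u')); 0, w' / w, 0; 0, 0, (σ (u' / u))⁻¹] := by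
  have hσu0 : σ u ≠ 0 := fun h => hu0 (by rw [← hσσ u, h, map_zero])
  have hσu0' : σ u' ≠ 0 := fun h => hu0' (by rw [← hσσ u', h, map_zero])
  have hPX : ((p : GL (Fin 3) K) : Matrix (Fin 3) (Fin 3) K) *
      !![u' / u, 0, (u' / u) * (x' - x * (u * σ u) / (u' * σ u')); 0, w' / w, 0; 0, 0, (σ (u' / u))⁻¹] =
      ((p' : GL (Fin 3) K) : Matrix (Fin 3) (Fin 3) K) := by
    rw [hcoe, hcoe', map_div₀]
    ext i j
    fin_cases i <;> fin_cases j <;> simp [Matrix.mul_apply, Fin.sum_univ_three]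
    · field_simp
    · field_simp; ring
    · field_simp
    · field_simp
  have hinv : (((p : GL (Fin 3) K)⁻¹ : GL (Fin 3) K) : Matrix (Fin 3) (Fin 3) K) * ((p : GL (Fin 3) K) : Matrix (Fin 3) (Fin 3) K) = 1 := by
    rw [← Units.val_mul, inv_mul_cancel, Units.val_one]
  rw [Subgroup.coe_mul, Subgroup.coe_inv, Units.val_mul, ← hPX, ← Matrix.mul_assoc, hinv, Matrix.one_mul]

end Rho

section HOne

variable {K : Type*} [Field K] [Valued K ℤᵐ⁰] {ϖ : K} (σ : K →+* K) {J : Matrix (Fin 3) (Fin 3) K} (hJ : J = (StdForm.antidiagonal 3).over K)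

include hJ in
/-- **(H1) THE FIBRES OF `ρ_m` ARE THE `N₀(ϖ^m)`-COSETS**: for `p, p′ ∈ P_H`, `ρ_m p = ρ_m p′ ↔ p⁻¹ p′ ∈ N₀(ϖ^m)`.  In coordinates both sides say
`u w⁻¹ ≡ u′ w′⁻¹` and `x ≡ x′ (mod ϖ^m)` — for the right side through `p⁻¹p′ = p(u′∕u, x′ − x·N(u)∕N(u′), w′∕w)` and `N(u) ≡ N(u′) (mod ϖ^m)` on such pairs
(`N(w) = N(w′) = 1`). [cite: Flicker1998UnitaryFL, Prop. 8 pp. 84–85] -/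
theorem flickerPHRho_eq_iff (hd : LocalConjDatum σ ϖ) {c : ↥(unitaryGroupOfForm σ J)}
    (hc : ((c : GL (Fin 3) K) : Matrix (Fin 3) (Fin 3) K) = !![1, 0, 0; 0, -1, 0; 0, 0, 1]) (m : ℕ)
    {p p' : ↥(unitaryGroupOfForm σ J)} (hp : p ∈ flickerPH σ J c) (hp' : p' ∈ flickerPH σ J c) :
    flickerPHRho σ m p = flickerPHRho σ m p' ↔ p⁻¹ * p' ∈ flickerPH0 σ J c (ϖ ^ m) := by
  have hσσ : ∀ a, σ (σ a) = a := hd.σσ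
  obtain ⟨u, x, w, hcoe, hu, hx, -, hw, hσw⟩ := exists_coe_eq_borel_of_mem_flickerPH σ hJ hd hc hp
  obtain ⟨u', x', w', hcoe', hu', hx', -, hw', hσw'⟩ := exists_coe_eq_borel_of_mem_flickerPH σ hJ hd hc hp'
  have hu0 : u ≠ 0 := fun h => by rw [h, map_zero] at hu; exact zero_ne_one hu
  have hw0 : w ≠ 0 := fun h => by rw [h, map_zero] at hw; exact zero_ne_one hw
  have hu0' : u' ≠ 0 := fun h => by rw [h, map_zero] at hu'; exact zero_ne_one hu'
  have hw0' : w' ≠ 0 := fun h => by rw [h, map_zero] at hw'; exact zero_ne_one hw'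
  have hσu0 : σ u ≠ 0 := fun h => hu0 (by rw [← hσσ u, h, map_zero])
  have hσu0' : σ u' ≠ 0 := fun h => hu0' (by rw [← hσσ u', h, map_zero])
  have vσu : Valued.v (σ u) = 1 := by rw [hd.vσ, hu]
  have vσu' : Valued.v (σ u') = 1 := by rw [hd.vσ, hu']
  have va : Valued.v (u * w⁻¹) ≤ 1 := by rw [map_mul, map_inv₀, hu, hw, inv_one, one_mul]
  have vb : Valued.v (u' * w'⁻¹) ≤ 1 := by rw [map_mul, map_inv₀, hu', hw', inv_one, one_mul]
  rw [flickerPHRho_of_coe_eq σ m hcoe hu0, flickerPHRho_of_coe_eq σ m hcoe' hu0', Prod.mk.injEq,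
    toQuotPow_eq_toQuotPow_iff hd.vϖ m va vb, toQuotPow_eq_toQuotPow_iff hd.vϖ m hx hx']
  have hmem : p⁻¹ * p' ∈ flickerPH σ J c := Subgroup.mul_mem _ (Subgroup.inv_mem _ hp) hp'
  have hcoe'' := coe_inv_mul_of_coe_eq σ hσσ hcoe hcoe' hu0 hw0 hu0'
  have hu'' : Valued.v (u' / u) = 1 := by rw [map_div₀, hu, hu', div_one]
  have hw'' : Valued.v (w' / w) = 1 := by rw [map_div₀, hw, hw', div_one]
  have hσw'' : σ (w' / w) * (w' / w) = 1 := by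
    rw [map_div₀, div_mul_div_comm, hσw', hσw, div_one]
  rw [mem_flickerPH0_iff_of_coe_eq σ hJ hd.vσ hσσ hmem hcoe'' hu'' hw'' hσw'' (ϖ ^ m)]
  -- the two valuation identities
  set D : K := u * w⁻¹ - u' * w'⁻¹ with hD
  have e1 : Valued.v (u' / u * (w' / w)⁻¹ - 1) = Valued.v D := by
    have : u' / u * (w' / w)⁻¹ - 1 = -D * (w / u) := by rw [hD]; field_simp; ring
    rw [this, map_mul, Valuation.map_neg, map_div₀, hu, hw, div_one, mul_one]
  set r : K := x * (u * σ u) / (u' * σ u') with hr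
  have e2 : Valued.v (x' - r) = Valued.v ((x' - x) - x * ((u * σ u) / (u' * σ u') - 1)) := by
    congr 1; rw [hr]; ring
  -- `N(u) ≡ N(u′)` modulo `D`
  have e3 : Valued.v ((u * σ u) / (u' * σ u') - 1) ≤ Valued.v D := by
    have hN : u * σ u - u' * σ u' = (D * w * w') * σ (u * w') + (u' * w) * σ (D * w * w') := by
      have hsw : σ w = w⁻¹ := by rw [← mul_eq_one_iff_eq_inv₀ hw0]; exact hσw
      have hsw' : σ w' = w'⁻¹ := by rw [← mul_eq_one_iff_eq_inv₀ hw0']; exact hσw'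
      rw [hD]; simp only [map_mul, map_sub, map_inv₀, hsw, hsw']; field_simp; ring
    have : (u * σ u) / (u' * σ u') - 1 = (u * σ u - u' * σ u') / (u' * σ u') := by field_simp
    rw [this, map_div₀, map_mul, hu', vσu', mul_one, div_one, hN]
    refine Valuation.map_add_le _ ?_ ?_
    · simp only [map_mul, hd.vσ, hu, hw, hw', mul_one, le_refl]
    · simp only [map_mul, hd.vσ, hu', hw, hw', mul_one, one_mul, le_refl]
  constructor
  · rintro ⟨h1, h2⟩
    refine ⟨by rwa [e1], ?_⟩
    rw [e2]
    refine Valuation.map_sub_le _ (by rw [← Valuation.map_neg, neg_sub]; exact h2) ?_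
    rw [map_mul]; exact (mul_le_mul' hx (e3.trans h1)).trans (by rw [one_mul])
  · rintro ⟨h1, h2⟩
    rw [e1] at h1
    refine ⟨h1, ?_⟩
    have : x - x' = -((x' - r) + x * ((u * σ u) / (u' * σ u') - 1)) := by rw [hr]; ring
    rw [this, Valuation.map_neg]
    refine Valuation.map_add_le _ h2 ?_
    rw [map_mul]; exact (mul_le_mul' hx (e3.trans h1)).trans (by rw [one_mul])

end HOne

section HThree

variable {K : Type*} [Field K] [Valued K ℤᵐ⁰] {ϖ : K} (σ : K →+* K) {J : Matrix (Fin 3) (Fin 3) K} (hJ : J = (StdForm.antidiagonal 3).over K)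

/-- A valuation-preserving `σ` maps `𝒪[K]` into itself (the hypothesis `hσO` of the restricted endomorphism
`σO := (σ.comp 𝒪[K].subtype).codRestrict 𝒪[K] hσO`). [cite: Flicker1998UnitaryFL, Prop. 8 p. 84] -/
theorem comp_subtype_mem_integer (hσv : ∀ a, Valued.v (σ a) = Valued.v a) (y : 𝒪[K]) : (σ.comp 𝒪[K].subtype) y ∈ 𝒪[K] := by
  change Valued.v (σ (y : K)) ≤ 1
  rw [hσv]; exact y.2

/-- `σO` preserves `𝓂^m` (so `σ` reduces to `𝒪⧸𝓂^m` via `Ideal.quotientMap`). [cite: Flicker1998UnitaryFL, Prop. 8 p. 84] -/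
theorem maximalIdeal_pow_le_comap_codRestrict (hϖ : Valued.v ϖ = WithZero.exp (-1 : ℤ)) (hσv : ∀ a, Valued.v (σ a) = Valued.v a)
    (hσO : ∀ y : 𝒪[K], (σ.comp 𝒪[K].subtype) y ∈ 𝒪[K]) (m : ℕ) :
    𝓂[K] ^ m ≤ (𝓂[K] ^ m).comap ((σ.comp 𝒪[K].subtype).codRestrict 𝒪[K] hσO) := by
  intro y hy
  rw [Ideal.mem_comap, mem_maximalIdeal_pow_iff_v_le hϖ]
  change Valued.v (σ (y : K)) ≤ _
  rw [hσv]
  exact (mem_maximalIdeal_pow_iff_v_le hϖ m y).1 hy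

include hJ in
/-- **(H3, first coordinate) `ρ_m(p)₁` is a unit** of `𝒪⧸𝓂^m` (`u w⁻¹ ∈ 𝒪^×`). [cite: Flicker1998UnitaryFL, Prop. 8 pp. 84–85] -/
theorem isUnit_flickerPHRho_fst (hd : LocalConjDatum σ ϖ) {c : ↥(unitaryGroupOfForm σ J)}
    (hc : ((c : GL (Fin 3) K) : Matrix (Fin 3) (Fin 3) K) = !![1, 0, 0; 0, -1, 0; 0, 0, 1]) (m : ℕ)
    {p : ↥(unitaryGroupOfForm σ J)} (hp : p ∈ flickerPH σ J c) : IsUnit (flickerPHRho σ m p).1 := by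
  obtain ⟨u, x, w, hcoe, hu, -, -, hw, -⟩ := exists_coe_eq_borel_of_mem_flickerPH σ hJ hd hc hp
  have hu0 : u ≠ 0 := fun h => by rw [h, map_zero] at hu; exact zero_ne_one hu
  have va : Valued.v (u * w⁻¹) = 1 := by rw [map_mul, map_inv₀, hu, hw, inv_one, one_mul]
  rw [flickerPHRho_of_coe_eq σ m hcoe hu0, toQuotPow_of_le m va.le]
  refine IsUnit.map _ ?_
  rw [(Valuation.integer.integers (Valued.v (R := K))).isUnit_iff_valuation_eq_one]
  exact va

include hJ in
/-- **(H3, second coordinate) `ρ_m(p)₂` is ANTI-FIXED** under the reduction `σ̄` of `σ` to `𝒪⧸𝓂^m` (`σx = −x`). [cite: Flicker1998UnitaryFL, Prop. 8 pp. 84–85] -/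
theorem quotientMap_flickerPHRho_snd (hd : LocalConjDatum σ ϖ) (hσO : ∀ y : 𝒪[K], (σ.comp 𝒪[K].subtype) y ∈ 𝒪[K])
    {c : ↥(unitaryGroupOfForm σ J)} (hc : ((c : GL (Fin 3) K) : Matrix (Fin 3) (Fin 3) K) = !![1, 0, 0; 0, -1, 0; 0, 0, 1]) (m : ℕ)
    {p : ↥(unitaryGroupOfForm σ J)} (hp : p ∈ flickerPH σ J c) :
    Ideal.quotientMap (𝓂[K] ^ m) ((σ.comp 𝒪[K].subtype).codRestrict 𝒪[K] hσO)
        (maximalIdeal_pow_le_comap_codRestrict σ hd.vϖ hd.vσ hσO m) (flickerPHRho σ m p).2 = -(flickerPHRho σ m p).2 := by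
  obtain ⟨u, x, w, hcoe, hu, hx, hσx, -, -⟩ := exists_coe_eq_borel_of_mem_flickerPH σ hJ hd hc hp
  have hu0 : u ≠ 0 := fun h => by rw [h, map_zero] at hu; exact zero_ne_one hu
  have hnx : Valued.v (-x) ≤ 1 := by rwa [Valuation.map_neg]
  rw [flickerPHRho_of_coe_eq σ m hcoe hu0, toQuotPow_of_le m hx, Ideal.quotientMap_mk, ← map_neg]
  congr 1
  apply Subtype.ext
  change σ x = -x
  exact hσx

include hJ in
/-- **(H3, surjectivity) every pair `(unit, anti-fixed class)` is a value of `ρ_m` on `P_H`**: given `a ∈ 𝒪^×` and `b ∈ 𝒪` with `σ̄ b̄ = −b̄ (mod 𝓂^m)`,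
the element `p(a, x, 1) ∈ P_H` with `x := (b − σb)∕2` (EXACTLY anti-fixed, `≡ b`) has `ρ_m = (ā, b̄)`.  With (H3₁), (H3₂): the image of `ρ_m` on `P_H` is
`(𝒪⧸𝓂^m)ˣ × {anti-fixed}`, of size `(q²−1)q^{2m−2} · q^m` (★ `natCard_units_quotient_pow`, ★ `natCard_antifixed_quotient_pow`). [cite: Flicker1998UnitaryFL, Prop. 8 pp. 84–85] -/
theorem exists_mem_flickerPH_flickerPHRho_eq (hd : LocalConjDatum σ ϖ) (hσO : ∀ y : 𝒪[K], (σ.comp 𝒪[K].subtype) y ∈ 𝒪[K])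
    {c : ↥(unitaryGroupOfForm σ J)} (hc : ((c : GL (Fin 3) K) : Matrix (Fin 3) (Fin 3) K) = !![1, 0, 0; 0, -1, 0; 0, 0, 1]) (m : ℕ)
    (a b : 𝒪[K]) (ha : Valued.v (a : K) = 1)
    (hb : Ideal.quotientMap (𝓂[K] ^ m) ((σ.comp 𝒪[K].subtype).codRestrict 𝒪[K] hσO)
        (maximalIdeal_pow_le_comap_codRestrict σ hd.vϖ hd.vσ hσO m) (Ideal.Quotient.mk (𝓂[K] ^ m) b) = -Ideal.Quotient.mk (𝓂[K] ^ m) b) :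
    ∃ p : ↥(unitaryGroupOfForm σ J), p ∈ flickerPH σ J c ∧
      flickerPHRho σ m p = (Ideal.Quotient.mk (𝓂[K] ^ m) a, Ideal.Quotient.mk (𝓂[K] ^ m) b) := by
  have h2v : Valued.v (2 : K) = 1 := hd.v2
  have h2 : (2 : K) ≠ 0 := fun h => by rw [h, map_zero] at h2v; exact zero_ne_one h2v
  have hσσ : ∀ t, σ (σ t) = t := hd.σσ
  set x : K := ((b : K) - σ b) / 2 with hx_def
  have hσ2 : σ 2 = 2 := by rw [map_ofNat]
  have hσx : σ x = -x := by rw [hx_def, map_div₀, map_sub, hσσ, hσ2]; ring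
  have hx : Valued.v x ≤ 1 := by
    rw [hx_def, map_div₀, h2v, div_one]
    exact Valuation.map_sub_le _ b.2 (by rw [hd.vσ]; exact b.2)
  have ha0 : (a : K) ≠ 0 := fun h => by rw [h, map_zero] at ha; exact zero_ne_one ha
  obtain ⟨p, hp, hcoe⟩ := exists_mem_flickerPH_coe_eq σ hJ hd hc ha hx hσx (by rw [map_one] : Valued.v (1 : K) = 1) (by rw [map_one, mul_one])
  refine ⟨p, hp, ?_⟩
  rw [flickerPHRho_of_coe_eq σ m hcoe ha0, inv_one, mul_one, toQuotPow_of_le m a.2, toQuotPow_of_le m hx, Prod.mk.injEq]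
  refine ⟨rfl, ?_⟩
  -- `x ≡ b (mod 𝓂^m)`: `x − b = −(b + σb)∕2` and `σ̄ b̄ = −b̄`
  rw [Ideal.quotientMap_mk, ← map_neg, Ideal.Quotient.eq] at hb
  rw [Ideal.Quotient.eq, mem_maximalIdeal_pow_iff_v_le hd.vϖ]
  have hb' := (mem_maximalIdeal_pow_iff_v_le hd.vϖ m _).1 hb
  change Valued.v (σ (b : K) - -(b : K)) ≤ _ at hb'
  change Valued.v (x - (b : K)) ≤ _
  have : x - (b : K) = -(2⁻¹) * (σ (b : K) - -(b : K)) := by rw [hx_def]; field_simp; ring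
  rw [this, map_mul, Valuation.map_neg, map_inv₀, h2v, inv_one, one_mul]
  exact hb'

end HThree

end UnitaryGroup

end Literature.NumberTheory.Automorphic
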